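import Mathlib
import Summits.Langlands.Langlands.Theses.NonParallelVoid
import Literature.NumberTheory.GaloisRepresentations.PstCrystallineExtensionData
import Literature.NumberTheory.GaloisRepresentations.EnormousSubgroup
import Literature.NumberTheory.GaloisRepresentations.ProjectiveType
import Literature.NumberTheory.GaloisRepresentations.ProjectiveTypeSolvable
import Literature.NumberTheory.GaloisRepresentations.DecomposedGeneric
import Literature.NumberTheory.GaloisRepresentations.DecomposedGenericOfQuadratic
import Literature.NumberTheory.GaloisRepresentations.AbsGaloisGroup
import Literature.NumberTheory.GaloisRepresentations.ResidualRepRestrict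
import Literature.NumberTheory.GaloisRepresentations.ResidualRepUnique
import Literature.NumberTheory.GaloisRepresentations.ResiduallyReducibleOfStableLine
import Literature.NumberTheory.GaloisRepresentations.TeichmullerLiftMonomial
import Literature.NumberTheory.GaloisRepresentations.CalegariEvenFontaineMazurTwo
import Literature.NumberTheory.Automorphic.Qian2022PotentialAutomorphy
import Literature.RepresentationTheory.Semisimple.IrreducibleOfCharpoly
import Literature.RingTheory.Valuation.AlgClosedResidue
import Literature.NumberTheory.GaloisRepresentations.TraceTwistMonomial
import HarnessLib

/-!
# Stub `stub_dihedralType_of_trace` of line `merged`, crux `TensorSquareParallel`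
# (stmt-Langlands-17009): the trace predicate `tr ρ̄ = η · tr ρ̄` on `Γ_{F(ζ_p)}` means
# projectively dihedral

Route `NonParallelVoid`, crux
`Summit.Langlands.Langlands.Theses.NonParallelVoid.TensorSquareParallel`, line `merged`, stub 4
(registered signature, verbatim, as `stub_dihedralType_of_trace` below).

## Content (everything PROVED; no definition, no named fact)

Informal statement.  Let `F` be a number field, `p ≥ 11` a prime, `ρ : Γ_F → GL₂(ℚ̄_p)`
continuous with `ρ|_{Γ_{F(ζ_p)}}` residually absolutely irreducible, and suppose that for the
tree's residual representation `ρ̄ = ρ.residualRep : Γ_F → GL₂(ℤ̄_p/𝔪)` there is a character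
`η : Γ_{F(ζ_p)} → (ℤ̄_p/𝔪)ˣ`, `η ≠ 1`, with `tr ρ̄(σ) = η(σ) tr ρ̄(σ)` for all `σ ∈ Γ_{F(ζ_p)}`.
Then `r := ρ̄|_{Γ_{F(ζ_p)}}` is of dihedral type (projective image `≅ D_m`, `m ≥ 2`), has finite
image, and `p ∤ |r(Γ_{F(ζ_p)})|`.

Proof (elementary; `k = ℤ̄_p/𝔪` is algebraically closed of characteristic `p ≠ 2`).  Abstract core
(any group `Γ`, any `r : Γ → GL₂(k)` irreducible with finite image; the monomial normal form is
the tree's `Literature/NumberTheory/GaloisRepresentations/TraceTwistMonomial`, landed for this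
stub, and its consequences are `namespace TraceTwist` here):
`N := ker η`; for `g ∉ N`, `tr r(g) = 0`, so `r(g)² = -det r(g) · 1` (Cayley–Hamilton) has
non-zero trace `-2 det`, whence `g² ∈ N`, `η(g) = -1`, and `g g' ∈ N` for `g, g' ∉ N`.  If `r|_N`
had no common eigenvector, `r(N)` would span `M₂(k)` (Burnside for `GL₂`, tree
`span_eq_top_of_no_common_eigenvector`) and `X ↦ tr(r(g₀) X)` (`g₀ ∉ N`) would vanish on
`r(N) ⊆ r(g₀)⁻¹ (Γ ∖ N)`, hence identically — but it is `2` at `r(g₀)⁻¹`.  So `N` has a common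
eigenvector `v`; `w := r(g₀) v` is another (`N` is normal), `v, w` are independent (else `v` is a
common eigenvector of `r(Γ) = r(N) ∪ r(g₀) r(N)`), and in the basis `(v, w)` every `r(n)`,
`n ∈ N`, is diagonal and every `r(g)`, `g ∉ N`, antidiagonal.  Some diagonal `r(n)` is non-scalar
(else the projective image is `{1, \bar r(g₀)}`, cyclic, contradicting irreducibility,
`not_isIrreducible_of_isCyclicType`), so the tree's `isDihedralType_of_monomial` (applied to the
finite group `r(Γ)`, `projectiveImage_range_subtype`) gives dihedral type.  Coprimality: an
element `r(g)` of order `p` (Cauchy) is impossible — for `g ∈ N` its diagonal entries satisfy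
`a^p = 1`, so `a = 1` (Frobenius is injective); for `g ∉ N`, `r(g)^p = (-det)^{(p-1)/2} r(g)` has
trace `0 ≠ 2 = tr 1`.
Galois specialisation (`stub_dihedralType_of_trace`): `res : Γ_{F(ζ_p)-model} ↪ Γ_F` has image
the subgroup `absGaloisGroupAdjoinRootsOfUnity F p`
(`range_absGaloisRestrict_eq_absGaloisGroupAdjoinRootsOfUnity`), so `ρ̄ ∘ res` and
`ρ̄ ∘ subtype` have the same image and projective image; `ρ̄` is a residual representation of
`ρ` in rank two (`isResidualRepOf_residualRep_fin_two`), so it has finite image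
(`finite_range_of_isResidualRepOf`) and `ρ̄ ∘ res` has the residual characteristic polynomials of
`ρ|_{Γ_{F(ζ_p)}}`, the same as those of its absolutely irreducible reduction
(`HasResidualCharpolys.charpoly_eq`), hence is irreducible (`isIrreducible_of_charpoly_eq`,
Brauer–Nesbitt).

Sources: the dihedral/induced dictionary is Gelbart, *Three lectures …* (1997), §4.3 Prop. (ii)
and Lecture I Rem. 1.3 (1); Burnside's theorem is Curtis–Reiner (27.4); the context is ACC+
(Allen et al. 2023) Def. 6.2.28 / Rem. 6.1.4 and Calegari (2010) §2.  Design: no new definition;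
the abstract core is stated for bare homomorphisms `Γ →* GL (Fin 2) k` (tree vocabulary
`conjGL`, `GL2.IsDg/IsAd`, `HasCommonEigenvector`, `IsDihedralType`).  NOT here: the converse
(dihedral type ⇒ self-twist), enormousness of the image (neighbouring stub).
-/

noncomputable section

set_option linter.dupNamespace false  -- `Summit.Langlands.Langlands.…` is the mandated summit-side namespace (D-0022)

open scoped NumberField MatrixGroups
open IsDedekindDomain Field Matrix
open Literature.NumberTheory.GaloisRepresentations Literature.NumberTheory.PAdicHodge
  Literature.NumberTheory.Automorphic

namespace Summit.Langlands.Langlands.Theorems.TensorSquareParallel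

/-! ### Consequences of the monomial normal form: dihedral type, order prime to `p` -/

namespace TraceTwist

variable {Γ : Type*} [Group Γ] {k : Type*} [Field k]

/-- In the monomial frame of `exists_conjGL_isDg_isAd_of_trace_eq_mul`, **some diagonal
`P r(n) P⁻¹`, `n ∈ ker η`, is non-scalar** when `r` is irreducible (`k` algebraically closed):
otherwise `r(ker η)` is central, the projective image of `r` is contained in `⟨\bar r(g₀)⟩`
(`Γ = ker η ∪ g₀ ker η`), hence cyclic, and a representation of cyclic type is reducible
(tree `not_isIrreducible_of_isCyclicType`). [folklore] -/
theorem exists_mem_ker_apply_ne [IsAlgClosed k] (h2 : (2 : k) ≠ 0) {r : Γ →* GL (Fin 2) k}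
    {η : Γ →* kˣ}
    (htr : ∀ g, (r g).val.trace = (η g : k) * (r g).val.trace)
    (hirr : (toStdRepresentation r).IsIrreducible) {g₀ : Γ} (hg₀ : g₀ ∉ η.ker)
    {P : GL (Fin 2) k} (hDg : ∀ g, g ∈ η.ker → GL2.IsDg (conjGL P r g).val) :
    ∃ n, n ∈ η.ker ∧
      (conjGL P r n).val 0 0 ≠ (conjGL P r n).val 1 1 := by
  by_contra hall
  push Not at hall
  refine not_isIrreducible_of_isCyclicType r ?_ hirr
  have hcen : ∀ n ∈ η.ker, r n ∈ Subgroup.center (GL (Fin 2) k) := by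
    intro n hn
    have h1 : conjGL P r n ∈ Subgroup.center (GL (Fin 2) k) :=
      GL2.mem_center_iff.mpr ⟨(hDg n hn).1, (hDg n hn).2, hall n hn⟩
    have e : r n = P⁻¹ * conjGL P r n * P⁻¹⁻¹ := by rw [conjGL_apply]; group
    rw [e]
    exact Subgroup.Normal.conj_mem inferInstance _ h1 P⁻¹
  have hle : projectiveImage r ≤ Subgroup.zpowers (Matrix.ProjGenLinGroup.mk (r g₀)) := by
    rintro _ ⟨g, rfl⟩
    rw [MonoidHom.comp_apply]
    by_cases hg : g ∈ η.ker
    · rw [Matrix.ProjGenLinGroup.mk_eq_one.mpr (hcen g hg)]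
      exact one_mem _
    · have hmem : g₀⁻¹ * g ∈ η.ker :=
        mul_mem_ker_of_trace_eq_mul h2 htr (fun h => hg₀ (by simpa using η.ker.inv_mem h)) hg
      have e : r g = r g₀ * r (g₀⁻¹ * g) := by rw [← map_mul, mul_inv_cancel_left]
      rw [e, map_mul, Matrix.ProjGenLinGroup.mk_eq_one.mpr (hcen _ hmem), mul_one]
      exact Subgroup.mem_zpowers _
  exact isCyclic_of_injective (Subgroup.inclusion hle) (Subgroup.inclusion_injective hle)

/-- **A two-dimensional irreducible representation fixed on traces by a non-trivial character
twist is of dihedral type.**  Let `k` be algebraically closed with `2 ≠ 0` in `k`,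
`r : Γ → GL₂(k)` with finite image and irreducible standard representation, and `η : Γ → kˣ`,
`η ≠ 1`, with `tr r(g) = η(g) tr r(g)` for all `g`.  Then the projective image of `r` is dihedral
`D_m`, `m ≥ 2` (`IsDihedralType r`): in the frame of
`exists_conjGL_isDg_isAd_of_trace_eq_mul` the image is monomial with a non-scalar diagonal
element (`exists_mem_ker_apply_ne`) and an antidiagonal one (`r(g₀)`, `g₀ ∉ ker η`), so the
tree's `isDihedralType_of_monomial` applies to the finite group
`r(Γ)` (`projectiveImage_range_subtype`, `isDihedralType_of_conjGL`).  Gelbart 1997, Lecture I,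
Rem. 1.3 (1) and §4.3 Prop. (ii) (dihedral type = monomial = induced from a quadratic
subgroup). [cite: Gelbart1997, Lecture I, Remark 1.3 (1) and §4.3 Proposition (ii)] -/
theorem isDihedralType_of_trace_eq_mul [IsAlgClosed k] (h2 : (2 : k) ≠ 0) (r : Γ →* GL (Fin 2) k)
    [Finite r.range] (hirr : (toStdRepresentation r).IsIrreducible) (η : Γ →* kˣ) (hη : η ≠ 1)
    (htr : ∀ g, (r g).val.trace = (η g : k) * (r g).val.trace) :
    IsDihedralType r := by
  obtain ⟨g₀, hg₀⟩ := exists_not_mem_ker_of_ne_one hη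
  have hce := not_hasCommonEigenvector_of_isIrreducible r hirr
  obtain ⟨P, hDg, hAd⟩ := exists_conjGL_isDg_isAd_of_trace_eq_mul h2 htr hce hg₀
  obtain ⟨n₀, hn₀, hne⟩ := exists_mem_ker_apply_ne h2 htr hirr hg₀ hDg
  set ι : r.range →* GL (Fin 2) k := r.range.subtype with hι
  have hPI : projectiveImage ι = projectiveImage r := projectiveImage_range_subtype r
  have hconj : ∀ (x : r.range) (g : Γ), (x : GL (Fin 2) k) = r g → conjGL P ι x = conjGL P r g := by
    intro x g hx
    rw [conjGL_apply, conjGL_apply, hι, Subgroup.subtype_apply, hx]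
  have hdih : IsDihedralType (conjGL P ι) := by
    refine isDihedralType_of_monomial (conjGL P ι) (fun x => ?_) ⟨⟨r n₀, n₀, rfl⟩, ?_⟩
      ⟨⟨r g₀, g₀, rfl⟩, ?_⟩
    · obtain ⟨g, hg⟩ := x.2
      rw [hconj x g hg.symm]
      by_cases hgN : g ∈ η.ker
      · exact Or.inl (hDg g hgN)
      · exact Or.inr (hAd g hgN)
    · rw [hconj _ n₀ rfl]
      exact ⟨hDg n₀ hn₀, hne⟩
    · rw [hconj _ g₀ rfl]
      exact hAd g₀ hg₀
  obtain ⟨m, hm, ⟨e⟩⟩ := isDihedralType_of_conjGL hdih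
  exact ⟨m, hm, ⟨(MulEquiv.subgroupCongr hPI.symm).trans e⟩⟩

/-- In characteristic `p`, `a ^ p = 1` forces `a = 1` (the Frobenius of a field is injective).
[folklore] -/
theorem eq_one_of_pow_char_eq_one {p : ℕ} [Fact p.Prime] [CharP k p] {a : k} (h : a ^ p = 1) :
    a = 1 := by
  apply frobenius_inj k p
  rw [frobenius_def, frobenius_def, one_pow]
  exact h

/-- **The image has order prime to the characteristic.**  In the situation of
`isDihedralType_of_trace_eq_mul` with `char k = p ≠ 2`, `p ∤ |r(Γ)|`: by Cauchy's theorem an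
element `r(g)` of order `p` would exist; if `g ∈ ker η` then `P r(g) P⁻¹ = diag(a, d)` with
`a^p = d^p = 1`, so `a = d = 1` (`eq_one_of_pow_char_eq_one`) and `r(g) = 1`; if `g ∉ ker η` then
`r(g)² = c · 1` and `r(g)^p = c^{(p-1)/2} r(g)` has trace `0`, while `tr 1 = 2 ≠ 0`. [folklore] -/
theorem not_char_dvd_card_range_of_trace_eq_mul [IsAlgClosed k] {p : ℕ} [Fact p.Prime] [CharP k p]
    (hp2 : p ≠ 2) (r : Γ →* GL (Fin 2) k) [Finite r.range]
    (hirr : (toStdRepresentation r).IsIrreducible) (η : Γ →* kˣ) (hη : η ≠ 1)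
    (htr : ∀ g, (r g).val.trace = (η g : k) * (r g).val.trace) :
    ¬ p ∣ Nat.card r.range := by
  have hp : p.Prime := Fact.out
  have h2 : (2 : k) ≠ 0 := fun h =>
    hp2 ((Nat.prime_dvd_prime_iff_eq hp Nat.prime_two).mp
      ((CharP.cast_eq_zero_iff k p 2).mp (by exact_mod_cast h)))
  obtain ⟨g₀, hg₀⟩ := exists_not_mem_ker_of_ne_one hη
  have hce := not_hasCommonEigenvector_of_isIrreducible r hirr
  obtain ⟨P, hDg, -⟩ := exists_conjGL_isDg_isAd_of_trace_eq_mul h2 htr hce hg₀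
  intro hdvd
  obtain ⟨x, hx⟩ := exists_prime_orderOf_dvd_card' p hdvd
  obtain ⟨g, hg⟩ := x.2
  have hxp : (r g) ^ p = 1 := by
    rw [hg, ← hx, ← Subgroup.coe_pow, pow_orderOf_eq_one, Subgroup.coe_one]
  have hx1 : r g ≠ 1 := by
    intro h1
    have e : x = 1 := Subtype.ext (by rw [← hg, h1, Subgroup.coe_one])
    rw [e, orderOf_one] at hx
    exact hp.one_lt.ne hx
  have hvp : (r g).val ^ p = 1 := by
    rw [← Units.val_pow_eq_pow_val, hxp, Units.val_one]
  by_cases hgN : g ∈ η.ker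
  · set X : Matrix (Fin 2) (Fin 2) k := (conjGL P r g).val with hX
    have hXp : X ^ p = 1 := by
      rw [hX, ← Units.val_pow_eq_pow_val, ← map_pow, conjGL_apply, map_pow, hxp, mul_one,
        mul_inv_cancel, Units.val_one]
    have hXd : X = Matrix.diagonal ![X 0 0, X 1 1] := (hDg g hgN).eq_diagonal
    have h00 : X 0 0 = 1 := by
      rw [hXd, Matrix.diagonal_pow] at hXp
      have e0 := congrFun (congrFun hXp 0) 0
      simp only [Matrix.diagonal_apply_eq, Pi.pow_apply, Matrix.cons_val_zero, Matrix.one_apply_eq]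
        at e0
      exact eq_one_of_pow_char_eq_one e0
    have h11 : X 1 1 = 1 := by
      rw [hXd, Matrix.diagonal_pow] at hXp
      have e1 := congrFun (congrFun hXp 1) 1
      simp only [Matrix.diagonal_apply_eq, Pi.pow_apply, Matrix.cons_val_one,
        Matrix.one_apply_eq] at e1
      exact eq_one_of_pow_char_eq_one e1
    apply hx1
    have hX1 : conjGL P r g = 1 := by
      refine Units.ext ?_
      change X = ((1 : GL (Fin 2) k) : Matrix (Fin 2) (Fin 2) k)
      rw [Units.val_one, hXd, h00, h11]
      ext i j
      fin_cases i <;> fin_cases j <;> simp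
    calc r g = P⁻¹ * (conjGL P r g) * P := by rw [conjGL_apply]; group
      _ = 1 := by rw [hX1]; group
  · have htr0 := trace_eq_zero_of_trace_eq_mul htr hgN
    have hsq := mul_self_eq_smul_one_of_trace_eq_mul htr hgN
    obtain ⟨m, hm⟩ := hp.odd_of_ne_two hp2
    have hpow : (r g).val ^ p =
        ((-(r g).val.det) ^ m) • (r g).val := by
      rw [hm, pow_succ, pow_mul, sq, hsq, smul_pow, one_pow, smul_mul_assoc, one_mul]
    rw [hvp] at hpow
    have := congrArg Matrix.trace hpow
    rw [Matrix.trace_one, Matrix.trace_smul, htr0, smul_zero, Fintype.card_fin] at this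
    exact h2 (by exact_mod_cast this)

end TraceTwist

/-! ### The stub: Galois specialisation -/

/-- **Stub 4 of line `merged` (crux `TensorSquareParallel`, stmt-Langlands-17009): the trace
predicate means projectively dihedral.**  For a number field `F`, a prime `p ≥ 11` and
`ρ : Γ_F → GL₂(ℚ̄_p)` with `ρ|_{Γ_{F(ζ_p)}}` residually absolutely irreducible: if some character
`η ≠ 1` of `Γ_{F(ζ_p)}` (through the model `CyclotomicField p F` and `absGaloisRestrict`) satisfies
`tr ρ̄(σ) = η(σ) · tr ρ̄(σ)` on `Γ_{F(ζ_p)}` for the tree's residual representation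
`ρ̄ = ρ.residualRep`, then `ρ̄` restricted to the subgroup `absGaloisGroupAdjoinRootsOfUnity F p`
is of dihedral type (`D_m`, `m ≥ 2`), has finite image, and its image has order prime to `p`.
(The quadratic, totally complex and `11 ≤ p` hypotheses are only used through `p ≠ 2`.)
Informally: "`ρ̄ ≅ ρ̄ ⊗ η` with `η ≠ 1` ⟹ `ρ̄ ≅ Ind(θ)` from the quadratic extension cut out by `η`"
(Gelbart 1997, §4.3, Proposition (ii), dihedral type = monomial; ACC+ Rem. 6.1.4 for the use).
[cite: Gelbart1997, Lecture I, Remark 1.3 (1) and §4.3 Prop. (ii)]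
[cite: ACCGHLNSTT2023, Def. 6.2.28 and Rem. 6.1.4 (context)] -/
theorem stub_dihedralType_of_trace :
    ∀ (F : Type) [Field F] [NumberField F] [Algebra.IsQuadraticExtension ℚ F], NumberField.IsTotallyComplex F → ∀ (p : ℕ) [Fact p.Prime] (ρ : FramedGaloisRep F (PadicAlgCl p) 2), 11 ≤ p → FramedGaloisRep.IsResiduallyAbsIrreducible (ρ.restrictField (CyclotomicField p F)) → (∃ η : absoluteGaloisGroup (CyclotomicField p F) →* (padicAlgClResidueField p)ˣ, η ≠ 1 ∧ ∀ σ : absoluteGaloisGroup (CyclotomicField p F), (ρ.residualRep (absGaloisRestrict F (CyclotomicField p F) σ)).val.trace = (η σ : padicAlgClResidueField p) * (ρ.residualRep (absGaloisRestrict F (CyclotomicField p F) σ)).val.trace) → IsDihedralType (ρ.residualRep.comp (absGaloisGroupAdjoinRootsOfUnity F p).subtype) ∧ Finite (ρ.residualRep.comp (absGaloisGroupAdjoinRootsOfUnity F p).subtype).range ∧ ¬ p ∣ Nat.card (ρ.residualRep.comp (absGaloisGroupAdjoinRootsOfUnity F p).subtype).range := by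
  intro F _ _ _ _ p _ ρ hp hirr hη
  obtain ⟨η, hη1, htr⟩ := hη
  have hpp : p.Prime := Fact.out
  haveI : NeZero ((p : ℕ) : F) := ⟨Nat.cast_ne_zero.mpr hpp.ne_zero⟩
  haveI : IsCyclotomicExtension {p} F (CyclotomicField p F) :=
    CyclotomicField.isCyclotomicExtension p F
  -- the coefficient field `k = ℤ̄_p/𝔪`: algebraically closed of characteristic `p ≠ 2`
  haveI : IsAlgClosed (padicAlgClResidueField p) :=
    Literature.RingTheory.Valuation.isAlgClosed_residueField (padicAlgClIntegers p)
  haveI : CharP (padicAlgClResidueField p) p := charP_padicAlgClResidueField p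
  have hp2 : p ≠ 2 := by omega
  have h2 : (2 : padicAlgClResidueField p) ≠ 0 := fun h =>
    hp2 ((Nat.prime_dvd_prime_iff_eq hpp Nat.prime_two).mp
      ((CharP.cast_eq_zero_iff _ p 2).mp (by exact_mod_cast h)))
  -- `r' = ρ̄ ∘ res` on `Γ_L`, `L = CyclotomicField p F`
  set res := (absGaloisRestrict F (CyclotomicField p F)).toMonoidHom with hres
  set r' : absoluteGaloisGroup (CyclotomicField p F) →* GL (Fin 2) (padicAlgClResidueField p) :=
    ρ.residualRep.comp res with hr'
  have htr' : ∀ σ, ((r' σ : GL (Fin 2) (padicAlgClResidueField p)) :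
      Matrix (Fin 2) (Fin 2) (padicAlgClResidueField p)).trace =
      (η σ : padicAlgClResidueField p) * ((r' σ : GL (Fin 2) (padicAlgClResidueField p)) :
        Matrix (Fin 2) (Fin 2) (padicAlgClResidueField p)).trace := fun σ => htr σ
  -- the images of `r'` and of `ρ̄ ∘ subtype` agree
  have hrange :
      r'.range = (ρ.residualRep.comp (absGaloisGroupAdjoinRootsOfUnity F p).subtype).range := by
    rw [hr', MonoidHom.range_comp, MonoidHom.range_comp, Subgroup.range_subtype]
    congr 1
    exact range_absGaloisRestrict_eq_absGaloisGroupAdjoinRootsOfUnity F (CyclotomicField p F) p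
  have hproj : projectiveImage r' =
      projectiveImage (ρ.residualRep.comp (absGaloisGroupAdjoinRootsOfUnity F p).subtype) := by
    rw [projectiveImage_eq_map_range, projectiveImage_eq_map_range, hrange]
  -- finite image
  have hspec := ρ.isResidualRepOf_residualRep_fin_two
  haveI hfin0 : Finite ρ.residualRep.range := FramedGaloisRep.finite_range_of_isResidualRepOf hspec
  haveI hfin : Finite r'.range := by
    have hle : r'.range ≤ ρ.residualRep.range := by
      rw [hr', MonoidHom.range_comp]; exact Subgroup.map_le_range _ _
    exact Finite.of_injective _ (Subgroup.inclusion_injective hle)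
  -- irreducibility of `r'` (lattice bridge: characteristic polynomials + Brauer–Nesbitt)
  have hirr' : (toStdRepresentation r').IsIrreducible := by
    obtain ⟨τL, hτL, habsL⟩ := hirr
    have h1 : HasResidualCharpolys (RingHom.id _)
        ((ρ.restrictField (CyclotomicField p F) :
            FramedGaloisRep (CyclotomicField p F) (PadicAlgCl p) 2) :
          absoluteGaloisGroup (CyclotomicField p F) →* GL (Fin 2) (PadicAlgCl p)) r' :=
      hspec.hasResidualCharpolys.comp res
    have hcp := fun h => h1.charpoly_eq hτL.hasResidualCharpolys h
    exact Literature.RepresentationTheory.Semisimple.isIrreducible_of_charpoly_eq r' τL hcp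
      habsL.isIrreducible
  -- conclusions for `r'`, transported along `hrange` / `hproj`
  have hdih := TraceTwist.isDihedralType_of_trace_eq_mul h2 r' hirr' η hη1 htr'
  have hndvd := TraceTwist.not_char_dvd_card_range_of_trace_eq_mul hp2 r' hirr' η hη1 htr'
  refine ⟨?_, ?_, ?_⟩
  · obtain ⟨m, hm, ⟨e⟩⟩ := hdih
    exact ⟨m, hm, ⟨(MulEquiv.subgroupCongr hproj.symm).trans e⟩⟩
  · rw [← hrange]; exact hfin
  · rw [← hrange]; exact hndvd

end Summit.Langlands.Langlands.Theorems.TensorSquareParallel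

end
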